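import Literature.NumberTheory.EllipticCurves.EichlerShimuraConstructionProofs
import Literature.NumberTheory.EllipticCurves.EichlerShimuraConstructionLatticeProofs
import Literature.NumberTheory.EllipticCurves.NewformsLevelEqOfHeckeEigenvalueEqProofs
import Literature.NumberTheory.EllipticCurves.NewformsEqOfHeckeEigenvalueEqProofs
import HarnessLib

/-!
# The Eichler–Shimura construction: reduction of `eichlerShimuraConstruction` to the tree's
# named facts, and Carayol's part from modularity

A proofs-only companion (theorems only, no definitions, no named facts) of
`Literature/NumberTheory/EllipticCurves/EichlerShimuraConstruction.lean`, whose assembled named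
fact `Literature.NumberTheory.EllipticCurves.ModularForms.eichlerShimuraConstruction` says: a
newform `f ∈ S₂(Γ₀(N))` with integer coefficients has a model `W/ℚ` of an elliptic curve with
`aₙ(f) = aₙ(W)` for **all** `n` (`IsNewformOf W f`; Knapp 1993, Thm. 11.74 (e) *with*
Thm. 12.8, Carayol) and `c Λ_f ⊆ Λ_E` for a nonzero integer `c` (Thm. 11.74 (c)–(d) with
Agashe–Ribet–Stein 2006, §2). A discharge would need the modular curve `X₀(N)` as an algebraic
curve over `ℚ` and over `𝔽_p`, its Jacobian, Hecke correspondences over `ℚ` and the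
Eichler–Shimura congruence relation — theories absent from Mathlib and from this tree. What is
proved here:

* `isNewformOf_of_cuspCoeff_prime_eq` — **the part of Carayol's theorem (Knapp Thm. 12.8:
  "`L(s, E) = L(s, f)`, and `N` is the conductor of `E`") follows from modularity and strong
  multiplicity one**: if `E/ℚ` is elliptic and `a_p(f) = a_p(E)` for all primes outside a finite
  set, then `N = N_E` and `IsNewformOf W f` (`aₙ(f) = aₙ(E)` for all `n`). The newform
  `g ∈ S₂(Γ₀(N_E))` of `E` (`exists_isNewformOf`, Breuil–Conrad–Diamond–Taylor 2001, Thm. A —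
  the named fact taken as hypothesis `h₁`) has the same `T_p`-eigenvalues as `f` at almost all
  `p`, so `N = N_E` and `f = g` by the tree's *theorems*
  `IsNewform0.level_eq_of_heckeEigenvalue_eq_holds` and `IsNewform0.eq_of_heckeEigenvalue_eq_holds`
  (Atkin–Lehner 1970, Thm. 4; `NewformsLevelEqOfHeckeEigenvalueEqProofs`,
  `NewformsEqOfHeckeEigenvalueEqProofs`).
* `exists_isNewformOf_of_rational_isNewform0` — hence the weaker Eichler–Shimura fact of the
  tree, `exists_weierstrassCurve_of_rational_isNewform0` (`NewformGaloisRep.lean`: Shimura 1971,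
  Thm. 7.14 with 7.24; Knapp Thm. 11.74 (e) with the Remark on Igusa — a curve `W/ℚ` with
  `a_p(f) = a_p(W)` for `p ∤ N`), together with modularity, already gives a curve with
  `IsNewformOf W f` and `N = N_W` — the remark "in fact `E` may be taken of conductor `N` and then
  `aₙ(f) = aₙ(E)` for all `n`, by Carayol" of that file's docstring, as a theorem modulo (2).
* `eichlerShimuraConstruction_of_facts` and `eichlerShimuraConstruction_iff` — **the assembled
  fact is equivalent, granted modularity (`exists_isNewformOf`) and Faltings' isogeny theorem
  (`WeierstrassCurve.isIsogenous_iff_frobeniusTrace_eq`), to the conjunction of two named facts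
  already in the tree**: `exists_weierstrassCurve_of_rational_isNewform0` (at every level) and
  `IsNewformOf.exists_maninConstant_ne_zero` (`ModularParametrizationDegree.lean`: `c Λ_f ⊆ Λ_E`
  for every curve with newform `f`). Direction ⇒ is the tree's
  `exists_weierstrassCurve_of_rational_isNewform0_of` and `exists_maninConstant_ne_zero_of`
  (with the lattice bookkeeping for `ℚ`-isogenies now a theorem,
  `neronLattice_commensurable_of_isIsogenous_holds`); direction ⇐ is the first bullet.

So the open content of `eichlerShimuraConstruction` beyond modularity is exactly: Knapp's
Thm. 11.74 (e) (`exists_weierstrassCurve_of_rational_isNewform0`) and the rationality of the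
period lattice of the optimal curve relative to `Λ_f` (Thm. 11.74 (c)–(d), PDF p. 302, with
Agashe–Ribet–Stein 2006, §2: `φ_E^* ω = c · 2πi f(z) dz`, `c ∈ ℚ^*`), the latter recorded in the
tree only inside the assembled facts `eichlerShimuraConstruction` and
`IsNewformOf.exists_maninConstant_ne_zero`. Nothing is discharged.

## References

* A. W. Knapp, *Elliptic Curves*, Math. Notes 40, Princeton 1993: Thm. 11.74 with the Remarks
  following it (PDF p. 287), Thm. 12.8 (PDF p. 301), PDF p. 302. [Knapp1993]
* C. Breuil, B. Conrad, F. Diamond, R. Taylor, *On the modularity of elliptic curves over `ℚ`: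
  wild 3-adic exercises*, J. Amer. Math. Soc. 14 (2001), 843–939: Thm. A; p. 845, "(2) ⇒ (6)".
  [BCDTJAMS2001]
* A. O. L. Atkin, J. Lehner, *Hecke operators on `Γ₀(m)`*, Math. Ann. 185 (1970), Thm. 4.
  [AtkinLehner1970]
* A. Agashe, K. Ribet, W. A. Stein, *The Manin constant*, Pure Appl. Math. Q. 2 (2006), 617–636:
  §2, p. 618. [AgasheRibetStein2006]
* G. Shimura, *Introduction to the arithmetic theory of automorphic functions*, 1971: Thm. 7.14,
  Thm. 7.24. [ShimuraIATAF1971]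
-/

noncomputable section

open scoped MatrixGroups ModularForm

open CongruenceSubgroup

namespace Literature.NumberTheory.EllipticCurves.ModularForms

/-! ### Integer coefficients -/

section Coefficients

/-- A cusp form all of whose Fourier coefficients are (images of) integers has coefficient
field `ℚ`: `K_f = ℚ(aₙ(f) : n) = ⊥` (Diamond–Shurman Def. 6.5.3). [folklore] -/
theorem coeffField_eq_bot_of_forall_exists_intCast {Γ : Subgroup (GL (Fin 2) ℝ)} {k : ℤ}
    {f : CuspForm Γ k} (hint : ∀ n : ℕ, ∃ a : ℤ, cuspCoeff f n = a) : coeffField f = ⊥ := by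
  rw [coeffField, IntermediateField.adjoin_eq_bot_iff]
  rintro _ ⟨n, rfl⟩
  obtain ⟨a, ha⟩ := hint n
  rw [SetLike.mem_coe, IntermediateField.mem_bot]
  refine ⟨(a : ℚ), ?_⟩
  rw [map_intCast]
  exact ha.symm

/-- For `N ≠ 0`, a prime outside the finite set of divisors of `N` does not divide `N` (the
exceptional set `{p ∣ N}` as a `Finset`). [folklore] -/
theorem not_dvd_of_notMem_divisors {N : ℕ} [NeZero N] {p : ℕ} (hp : p ∉ (N.divisors : Set ℕ)) :
    ¬ p ∣ N := fun h ↦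
  hp (Finset.mem_coe.mpr (Nat.mem_divisors.mpr ⟨h, NeZero.ne N⟩))

end Coefficients

/-! ### Carayol's part from modularity and strong multiplicity one -/

section Carayol

/-- **`a_p(f) = a_p(E)` for almost all `p` forces `N = N_E` and `aₙ(f) = aₙ(E)` for all `n`,
granted modularity.** Let `f ∈ S₂(Γ₀(N))` be a newform (`IsNewform0 f`), `E/ℚ` an elliptic curve
in any model `W`, and suppose `a_p(f) = a_p(W)` (`W.LFunction p`) for all primes `p` outside a
finite set `S`. By modularity (`exists_isNewformOf`, Breuil–Conrad–Diamond–Taylor 2001, Thm. A,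
the hypothesis `h₁`; `N_E > 0` by `conductorNorm_pos_holds`) `W` has a newform `g ∈ S₂(Γ₀(N_E))`
with `aₙ(g) = aₙ(W)` for all `n`; `f` and `g` then have the same `T_p`-eigenvalues
(`heckeEigenvalue_eq_coeff_of_isNormalized`: `T_p f = a_p(f) f` for a normalised eigenform) at the
primes `p ∉ S`, so `N = N_E` by strong multiplicity one across levels and `f = g` by strong
multiplicity one at level `N` (Atkin–Lehner 1970, Thm. 4; the tree's theorems
`IsNewform0.level_eq_of_heckeEigenvalue_eq_holds`, `IsNewform0.eq_of_heckeEigenvalue_eq_holds`).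
For the Eichler–Shimura curve of `f` this is the statement of Carayol's theorem as printed by
Knapp 1993, Thm. 12.8 ("Then `L(s, E) = L(s, f)`, and `N` is the conductor of `E`"), obtained
from modularity instead of Carayol 1986. [cite: AtkinLehner1970, Thm. 4] -/
theorem isNewformOf_of_cuspCoeff_prime_eq (h₁ : exists_isNewformOf) {N : ℕ} [NeZero N]
    {f : CuspForm (Gamma0 N) 2} (hf : IsNewform0 f) (W : WeierstrassCurve ℚ) [W.IsElliptic]
    {S : Set ℕ} (hS : S.Finite)
    (hfp : ∀ p : ℕ, p.Prime → p ∉ S → cuspCoeff f p = (W.LFunction p : ℂ)) :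
    IsNewformOf W f ∧ N = W.conductorNorm ℤ := by
  haveI : NeZero (W.conductorNorm ℤ) := ⟨(WeierstrassCurve.conductorNorm_pos_holds W).ne'⟩
  obtain ⟨g, hg⟩ := h₁ W
  have hfin : {p : ℕ | p.Prime ∧ heckeEigenvalue f p ≠ heckeEigenvalue g p}.Finite := by
    refine hS.subset ?_
    rintro p ⟨hp, hne⟩
    by_contra hpS
    apply hne
    rw [heckeEigenvalue_eq_coeff_of_isNormalized hf.2.2 hp (hf.2.1 p hp),
      heckeEigenvalue_eq_coeff_of_isNormalized hg.1.2.2 hp (hg.1.2.1 p hp)]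
    change cuspCoeff f p = cuspCoeff g p
    rw [hfp p hp hpS, hg.2 p]
  have hN : N = W.conductorNorm ℤ :=
    IsNewform0.level_eq_of_heckeEigenvalue_eq_holds hf hg.1 hfin
  refine ⟨?_, hN⟩
  subst hN
  rw [IsNewform0.eq_of_heckeEigenvalue_eq_holds hf hg.1 hfin]
  exact hg

/-- **Eichler–Shimura with level `=` conductor, from the weak Eichler–Shimura fact and
modularity.** For a newform `f ∈ S₂(Γ₀(N))` with coefficient field `ℚ` there is an elliptic curve
`W/ℚ` with `aₙ(f) = aₙ(W)` for all `n` (`IsNewformOf W f`) and `N = N_W`: the tree's named fact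
`exists_weierstrassCurve_of_rational_isNewform0` (Shimura 1971, Thm. 7.14 with 7.24; Knapp 1993,
Thm. 11.74 (e) with Remarks: `a_p(f) = a_p(W)` for the primes `p ∤ N`), hypothesis `h₂`, and
`isNewformOf_of_cuspCoeff_prime_eq` (modularity `h₁` and strong multiplicity one) with the
exceptional set `{p ∣ N}`. This is Knapp's Thm. 11.74 (e) completed by Thm. 12.8 (Carayol:
"`L(s, E) = L(s, f)`, and `N` is the conductor of `E`"), for some curve in the isogeny class.
[cite: Knapp1993, Thm. 11.74 (e) with Remarks (PDF p. 287) and Thm. 12.8 (PDF p. 301)] -/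
theorem exists_isNewformOf_of_rational_isNewform0 (h₁ : exists_isNewformOf) {N : ℕ} [NeZero N]
    (h₂ : exists_weierstrassCurve_of_rational_isNewform0 (N := N)) {f : CuspForm (Gamma0 N) 2}
    (hf : IsNewform0 f) (hQ : coeffField f = ⊥) :
    ∃ (W : WeierstrassCurve ℚ) (_ : W.IsElliptic), IsNewformOf W f ∧ N = W.conductorNorm ℤ := by
  obtain ⟨W, hW, hap⟩ := h₂ f hf hQ
  haveI := hW
  exact ⟨W, hW, isNewformOf_of_cuspCoeff_prime_eq h₁ hf W N.divisors.finite_toSet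
    fun p hp hpS ↦ hap p hp (not_dvd_of_notMem_divisors hpS)⟩

end Carayol

/-! ### `eichlerShimuraConstruction` and the tree's named facts -/

section Reduction

/-- **`eichlerShimuraConstruction` from modularity and two named facts of the tree.** Given a
newform `f ∈ S₂(Γ₀(N))` with integer coefficients (so `K_f = ℚ`,
`coeffField_eq_bot_of_forall_exists_intCast`), the weak Eichler–Shimura fact
`exists_weierstrassCurve_of_rational_isNewform0` and modularity give `W/ℚ` with `IsNewformOf W f`
(`exists_isNewformOf_of_rational_isNewform0`), and `IsNewformOf.exists_maninConstant_ne_zero`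
(`ModularParametrizationDegree.lean`: `c Λ_f ⊆ Λ_E`, `c ∈ ℤ ∖ {0}`, for every curve with newform
`f` and every Néron-type period pair) supplies the lattice clause for this very `W`.
[cite: Knapp1993, Thm. 11.74 with Remarks (PDF p. 287) and Thm. 12.8 (PDF p. 301)] -/
theorem eichlerShimuraConstruction_of_facts (h₁ : exists_isNewformOf)
    (h₂ : ∀ (N : ℕ) [NeZero N], exists_weierstrassCurve_of_rational_isNewform0 (N := N))
    (h₃ : IsNewformOf.exists_maninConstant_ne_zero) : eichlerShimuraConstruction := by
  intro N _ f hf hint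
  obtain ⟨W, hW, hWf, -⟩ := exists_isNewformOf_of_rational_isNewform0 h₁ (h₂ N) hf
    (coeffField_eq_bot_of_forall_exists_intCast hint)
  haveI := hW
  exact ⟨W, hW, hWf, fun {L} hL ↦ h₃ hWf hL⟩

/-- **What `eichlerShimuraConstruction` amounts to, granted modularity and Faltings.** Modulo
the named facts `exists_isNewformOf` (Breuil–Conrad–Diamond–Taylor 2001, Thm. A) and
`WeierstrassCurve.isIsogenous_iff_frobeniusTrace_eq` (Faltings 1983), the assembled fact
`eichlerShimuraConstruction` is equivalent to the conjunction of the tree's named facts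
`exists_weierstrassCurve_of_rational_isNewform0` (at every level `N ≥ 1`; Knapp Thm. 11.74 (e))
and `IsNewformOf.exists_maninConstant_ne_zero` (commensurability of `Λ_f` and `Λ_E` for every
curve with newform `f`). ⇒: `exists_weierstrassCurve_of_rational_isNewform0_of`
(`EichlerShimuraConstructionProofs.lean`) and `exists_maninConstant_ne_zero_of`
(`EichlerShimuraConstruction.lean`, with Faltings and the lattice bookkeeping for `ℚ`-isogenies,
the latter being the theorem `neronLattice_commensurable_of_isIsogenous_holds`);
⇐: `eichlerShimuraConstruction_of_facts`.
[cite: BCDTJAMS2001, p. 845, "(2) ⇒ (6)"] -/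
theorem eichlerShimuraConstruction_iff (h₁ : exists_isNewformOf)
    (hF : WeierstrassCurve.isIsogenous_iff_frobeniusTrace_eq) :
    eichlerShimuraConstruction ↔
      (∀ (N : ℕ) [NeZero N], exists_weierstrassCurve_of_rational_isNewform0 (N := N)) ∧
        IsNewformOf.exists_maninConstant_ne_zero :=
  ⟨fun hES ↦ ⟨fun _ _ ↦ exists_weierstrassCurve_of_rational_isNewform0_of hES,
      exists_maninConstant_ne_zero_of hES hF neronLattice_commensurable_of_isIsogenous_holds⟩,
    fun h ↦ eichlerShimuraConstruction_of_facts h₁ h.1 h.2⟩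

end Reduction

end Literature.NumberTheory.EllipticCurves.ModularForms

end
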